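import Mathlib
import HarnessLib
import Literature.Analysis.FluidPDE.ClassicalSolution
import Literature.Analysis.FluidPDE.ClassicalL2Stability
import Literature.Analysis.FluidPDE.TaoEnstrophyLocalisationProofs

/-!
# Route QuarterJolt — crux `NoTerminalJolt` (stmt-NavierStokesRegularity-26463): the EDGE LAW, I.
# The slice inequality for static fields

Seat ns-qj-p1 g2 (route QuarterJolt supports; `--supports 26463 --as helper`). First of four files
(`QuarterJoltEdgeLawSlice` → `QuarterJoltEdgeLawClass` → `QuarterJoltEdgeLawSlab` →
`QuarterJoltEdgeLaw`) proving the EDGE LAW planned by the crux LEAD (ns-ntj-p1 g0,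
`Cruxes/NoTerminalJolt/Lines/regular_split.md` §EDGE LAW) and named by the refuter audit of the crux
(refuter1-g10, 2026-08-28: «first provable target = … the O((T−t)^{1/4}) upper law under EQL»): in the
frame of the crux, the slice law `∫|curl u(t)|² ≤ K/√(T−t)` forces
`‖u(t) − u(T)‖₂² = O(√(T−t))`, i.e. the jolt functional `D(t) = (√(T−t))⁻¹‖u(t) − u(T)‖₂²` is
BOUNDED — the quarter law reaches exactly the edge `α = 1/4` of the family
`‖u(t) − u(T)‖₂ = O((T−t)^α)`, while the crux asks `D → 0`.

THIS FILE: the one-slice inequality behind the energy method, for STATIC fields (no time):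
`slice_le` — if `v ∈ C²` is divergence free with `|v| ≤ M`, `v, Dv, D²v ∈ L²`, `W ∈ C⁰ ∩ L²`,
`π ∈ C¹ ∩ L²` with `W + (v·∇)v = νΔv − ∇π` (`ν ≥ 0`), and `U ∈ C¹` is divergence free with
`U, DU ∈ L²`, then for every `λ > 0`
`2∫⟪v − U, W⟫ ≤ (ν/2)∫|DU|²_F + λ∫‖v − U‖² + (M²/λ)∫|Dv|²_F`.
Ingredients (all tree theorems): whole-space integration by parts in the `L²` class
`integral_sum_inner_fderiv_fderiv_eq_neg_integral_inner_laplacian` (`∫⟪v−U, Δv⟫ = −∫Dv:(Dv−DU)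
≤ ¼∫|DU|²`), `integral_inner_gradient_eq_zero_of_isDivFree_R3` (the pressure pairs to zero with the
divergence-free `L²` field `v − U`), and the pointwise Young inequality
`−⟪v−U, (v·∇)v⟫ ≤ (λ/2)‖v−U‖² + (M²/(2λ))|Dv|²_F` (no integration by parts of the transport term is
needed: the frozen field `U` is NOT transported, which is why the method stops at the edge).

References: energy method as in Majda–Bertozzi 2002 §3.1 / Robinson–Rodrigo–Sadowski 2016 Thm. 6.10
(tree file `ClassicalL2Stability`); Leslie–Shvydkoy, arXiv:1705.04420, Thm. 1.2 (Type-I in time ⇒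
energy equality at the blow-up time: the `α = 0` member).

HONEST FRAMING: a conditional statement about a HYPOTHETICAL quarter-law blow-up (it calibrates the
crux; it does not move it). Nothing here proves `EnstrophyQuarterLaw` (stmt-1574), `NoTerminalJolt`
(stmt-26463) or Navier–Stokes regularity; all three stay OPEN. No summit statement is proved here.
[folklore]
-/

noncomputable section

-- the summit and its single sub-problem share the name (CONVENTIONS §1), as in every Theorems file
set_option linter.dupNamespace false

namespace Summit.NavierStokesRegularity.NavierStokesRegularity.Theorems

open MeasureTheory Set Function Filter Topology InnerProductSpace
open scoped ENNReal NNReal ContDiff RealInnerProductSpace Laplacian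
open Literature.Analysis.FluidPDE

namespace EdgeLaw

/-- Pointwise algebra of the viscous cross term: `−⟪a, a − b⟫ ≤ ‖b‖²/4`
(`‖a − b/2‖² ≥ 0`). [folklore] -/
theorem neg_inner_self_sub_le (a b : EuclideanSpace ℝ (Fin 3)) : -⟪a, a - b⟫ ≤ ‖b‖ ^ 2 / 4 := by
  rw [inner_sub_right, real_inner_self_eq_norm_sq]
  have h1 : ⟪a, b⟫ ≤ ‖a‖ * ‖b‖ := real_inner_le_norm _ _
  nlinarith [sq_nonneg (‖a‖ - ‖b‖ / 2), norm_nonneg a, norm_nonneg b]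

/-- Pointwise Young inequality for the transport pairing: `−⟪z, L v⟫ ≤ (λ/2)‖z‖² + (M²/(2λ))|L|²_F`
when `‖v‖ ≤ M`, `λ > 0` (`‖L v‖ ≤ ‖L‖ M ≤ |L|_F M`). [folklore] -/
theorem neg_inner_apply_le (z v : EuclideanSpace ℝ (Fin 3))
    (L : EuclideanSpace ℝ (Fin 3) →L[ℝ] EuclideanSpace ℝ (Fin 3)) {M lam : ℝ} (hM : ‖v‖ ≤ M)
    (hlam : 0 < lam) :
    -⟪z, L v⟫ ≤ lam / 2 * ‖z‖ ^ 2 + M ^ 2 / (2 * lam) * frobeniusNormSq L := by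
  have hM0 : 0 ≤ M := (norm_nonneg _).trans hM
  have h1 : -⟪z, L v⟫ ≤ ‖z‖ * (‖L‖ * M) := by
    calc -⟪z, L v⟫ ≤ ‖z‖ * ‖L v‖ := by
          have := norm_inner_le_norm (𝕜 := ℝ) z (L v)
          rw [Real.norm_eq_abs] at this
          exact (neg_le_abs _).trans this
      _ ≤ ‖z‖ * (‖L‖ * M) :=
          mul_le_mul_of_nonneg_left ((L.le_opNorm v).trans
            (mul_le_mul_of_nonneg_left hM (norm_nonneg _))) (norm_nonneg _)
  have h2 : (‖L‖ * M) ^ 2 ≤ M ^ 2 * frobeniusNormSq L := by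
    rw [mul_pow, mul_comm]
    exact mul_le_mul_of_nonneg_left (sq_opNorm_le_frobeniusNormSq L) (sq_nonneg _)
  have h3 : ‖z‖ * (‖L‖ * M) ≤ lam / 2 * ‖z‖ ^ 2 + (‖L‖ * M) ^ 2 / (2 * lam) := by
    have hb : 0 ≤ ‖L‖ * M := mul_nonneg (norm_nonneg _) hM0
    rw [← sub_nonneg]
    have e : lam / 2 * ‖z‖ ^ 2 + (‖L‖ * M) ^ 2 / (2 * lam) - ‖z‖ * (‖L‖ * M) =
        (lam * ‖z‖ - ‖L‖ * M) ^ 2 / (2 * lam) := by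
      field_simp
      ring
    rw [e]
    positivity
  have h4 : (‖L‖ * M) ^ 2 / (2 * lam) ≤ M ^ 2 / (2 * lam) * frobeniusNormSq L := by
    rw [div_mul_eq_mul_div]
    exact div_le_div_of_nonneg_right h2 (by positivity)
  linarith

/-- **The slice inequality of the edge law (static fields).** Let `v ∈ C²(ℝ³; ℝ³)` be divergence
free and bounded by `M`, with `v, Dv, D²v ∈ L²`; `W : ℝ³ → ℝ³` continuous and in `L²`; `π ∈ C¹ ∩ L²`;
and the momentum equation `W + (v·∇)v = νΔv − ∇π` (`ν ≥ 0`). Let `U ∈ C¹` be divergence free with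
`U, DU ∈ L²` (the frozen slice). Then for every `λ > 0`
`2∫⟪v − U, W⟫ ≤ (ν/2)∫|DU|²_F + λ∫‖v − U‖² + (M²/λ)∫|Dv|²_F`.
Proof: `∫⟪v−U, Δv⟫ = −∫ Dv:(Dv − DU) ≤ ¼∫|DU|²_F`
(`integral_sum_inner_fderiv_fderiv_eq_neg_integral_inner_laplacian`), `∫⟪v−U, ∇π⟫ = 0`
(`integral_inner_gradient_eq_zero_of_isDivFree_R3`), and `−⟪v−U, (v·∇)v⟫ ≤ (λ/2)‖v−U‖² +
(M²/(2λ))|Dv|²_F` pointwise. [folklore] -/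
theorem slice_le {ν : ℝ} (hν : 0 ≤ ν) {v U W : EuclideanSpace ℝ (Fin 3) → EuclideanSpace ℝ (Fin 3)}
    {π : EuclideanSpace ℝ (Fin 3) → ℝ}
    (hv : ContDiff ℝ 2 v) (hU : ContDiff ℝ 1 U) (hW : Continuous W) (hπ : ContDiff ℝ 1 π)
    (hmom : ∀ x, W x + convect v v x = ν • (Δ v) x - gradient π x)
    (hdivv : VectorCalculus.IsDivFree v) (hdivU : VectorCalculus.IsDivFree U)
    {M : ℝ} (hM : ∀ x, ‖v x‖ ≤ M)
    (l2v : ∫⁻ x, ‖v x‖ₑ ^ 2 < ⊤) (l2Dv : ∫⁻ x, ‖fderiv ℝ v x‖ₑ ^ 2 < ⊤)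
    (l2D2v : ∫⁻ x, ‖iteratedFDeriv ℝ 2 v x‖ₑ ^ 2 < ⊤)
    (l2U : ∫⁻ x, ‖U x‖ₑ ^ 2 < ⊤) (l2DU : ∫⁻ x, ‖fderiv ℝ U x‖ₑ ^ 2 < ⊤)
    (l2W : ∫⁻ x, ‖W x‖ₑ ^ 2 < ⊤) (l2π : ∫⁻ x, ‖π x‖ₑ ^ 2 < ⊤) {lam : ℝ} (hlam : 0 < lam) :
    2 * ∫ x, ⟪v x - U x, W x⟫ ≤
      ν / 2 * (∫ x, frobeniusNormSq (fderiv ℝ U x)) + lam * (∫ x, ‖v x - U x‖ ^ 2) +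
        M ^ 2 / lam * ∫ x, frobeniusNormSq (fderiv ℝ v x) := by
  set e := EuclideanSpace.basisFun (Fin 3) ℝ with he
  have he1 : ∀ i, ‖e i‖ = 1 := fun i => by simp [he]
  -- the difference `z = v - U` (opaque, with its equation)
  obtain ⟨z, hzdef⟩ : ∃ z : EuclideanSpace ℝ (Fin 3) → EuclideanSpace ℝ (Fin 3),
      z = fun x => v x - U x := ⟨_, rfl⟩
  have hzx : ∀ x, z x = v x - U x := fun x => by rw [hzdef]
  have hv1 : ContDiff ℝ 1 v := hv.of_le (by norm_num)
  have hz : ContDiff ℝ 1 z := by rw [hzdef]; exact hv1.sub hU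
  have hdv : Differentiable ℝ v := hv1.differentiable one_ne_zero
  have hdU : Differentiable ℝ U := hU.differentiable one_ne_zero
  have hfdz : ∀ x, fderiv ℝ z x = fderiv ℝ v x - fderiv ℝ U x := fun x => by
    rw [hzdef]; exact fderiv_fun_sub (hdv x) (hdU x)
  have hdivz : VectorCalculus.IsDivFree z := by
    intro x
    rw [divergence_eq_traceCLM, hfdz x, map_sub, ← divergence_eq_traceCLM,
      ← divergence_eq_traceCLM, hdivv x, hdivU x, sub_zero]
  -- continuity
  have cv : Continuous v := hv.continuous
  have cz : Continuous z := hz.continuous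
  have cDv : Continuous (fderiv ℝ v) := hv.continuous_fderiv (by norm_num)
  have cDz : Continuous (fderiv ℝ z) := hz.continuous_fderiv one_ne_zero
  have cD2v : Continuous fun x => iteratedFDeriv ℝ 2 v x := hv.continuous_iteratedFDeriv le_rfl
  have cπ : Continuous π := hπ.continuous
  have cDπ : Continuous (fderiv ℝ π) := hπ.continuous_fderiv one_ne_zero
  have cgπ : Continuous (gradient π) := continuous_gradient_of_contDiff hπ
  have cΔ : Continuous (Δ v) := continuous_laplacian hv
  have cdiv : ∀ i, Continuous fun x => fderiv ℝ v x (e i) := fun i =>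
    cDv.clm_apply continuous_const
  have cdiz : ∀ i, Continuous fun x => fderiv ℝ z x (e i) := fun i =>
    cDz.clm_apply continuous_const
  have cddv : ∀ i, Continuous fun x => fderiv ℝ (fun y => fderiv ℝ v y (e i)) x (e i) := fun i =>
    ((((hv.fderiv_right (m := 1) (by norm_num)).clm_apply contDiff_const).continuous_fderiv
      (by norm_num)).clm_apply continuous_const)
  have cdiπ : ∀ i, Continuous fun x => fderiv ℝ π x (e i) := fun i => cDπ.clm_apply continuous_const
  have cconv : Continuous (convect v v) := cDv.clm_apply cv
  -- pointwise norm facts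
  have hM0 : 0 ≤ M := (norm_nonneg _).trans (hM 0)
  have n_Δ : ∀ x, ‖(Δ v) x‖ ≤ ‖(3 : ℝ) • iteratedFDeriv ℝ 2 v x‖ := fun x => by
    rw [norm_smul, Real.norm_of_nonneg (by norm_num : (0 : ℝ) ≤ 3)]
    exact norm_laplacian_le_three_mul_norm_iteratedFDeriv_two hv x
  have n_gπ : ∀ x, ‖gradient π x‖ = ‖fderiv ℝ π x‖ := fun x => by
    rw [gradient, LinearIsometryEquiv.norm_map]
  have hin : ∀ i (y : EuclideanSpace ℝ (Fin 3)), ‖⟪e i, y⟫‖ ≤ ‖y‖ := fun i y =>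
    (norm_inner_le_norm (𝕜 := ℝ) (e i) y).trans (by rw [he1, one_mul])
  have n_conv : ∀ x, ‖convect v v x‖ ≤ ‖M * ‖fderiv ℝ v x‖‖ := fun x => by
    rw [Real.norm_of_nonneg (by positivity), convect, mul_comm]
    exact (fderiv ℝ v x).le_opNorm_of_le (hM x)
  -- the momentum equation solved for the pressure gradient
  have hgrad : ∀ x, gradient π x = ν • (Δ v) x - (W x + convect v v x) := fun x => by
    rw [hmom x]; abel
  -- finite `L²` norms
  have l2z : ∫⁻ x, ‖z x‖ₑ ^ 2 < ⊤ := by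
    refine lintegral_enorm_sq_lt_top_of_norm_le_add (fun x => ?_) cv.aestronglyMeasurable l2v l2U
    rw [hzx]; exact norm_sub_le _ _
  have l2Dz : ∫⁻ x, ‖fderiv ℝ z x‖ₑ ^ 2 < ⊤ := by
    refine lintegral_enorm_sq_lt_top_of_norm_le_add (fun x => ?_) cDv.aestronglyMeasurable l2Dv l2DU
    rw [hfdz]; exact norm_sub_le _ _
  have l2Δ : ∫⁻ x, ‖(Δ v) x‖ₑ ^ 2 < ⊤ :=
    lintegral_enorm_sq_lt_top_of_norm_le n_Δ (lintegral_enorm_sq_const_smul_lt_top 3 l2D2v)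
  have l2νΔ : ∫⁻ x, ‖ν • (Δ v) x‖ₑ ^ 2 < ⊤ := lintegral_enorm_sq_const_smul_lt_top ν l2Δ
  have l2conv : ∫⁻ x, ‖convect v v x‖ₑ ^ 2 < ⊤ := by
    have hb : ∫⁻ x, ‖M * ‖fderiv ℝ v x‖‖ₑ ^ 2 < ⊤ := by
      have h := lintegral_enorm_sq_const_smul_lt_top M
        (lintegral_enorm_sq_lt_top_of_norm_le (fun x => by rw [norm_norm]) l2Dv :
          ∫⁻ x, ‖(‖fderiv ℝ v x‖)‖ₑ ^ 2 < ⊤)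
      simpa only [smul_eq_mul] using h
    exact lintegral_enorm_sq_lt_top_of_norm_le n_conv hb
  have l2Wc : ∫⁻ x, ‖W x + convect v v x‖ₑ ^ 2 < ⊤ := by
    have hle : ∀ x, ‖W x + convect v v x‖ ≤ ‖W x‖ + ‖convect v v x‖ := fun x => norm_add_le _ _
    exact lintegral_enorm_sq_lt_top_of_norm_le_add hle hW.aestronglyMeasurable l2W l2conv
  have l2gπ : ∫⁻ x, ‖gradient π x‖ₑ ^ 2 < ⊤ := by
    have hle : ∀ x, ‖gradient π x‖ ≤ ‖ν • (Δ v) x‖ + ‖W x + convect v v x‖ := fun x => by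
      rw [hgrad x]; exact norm_sub_le _ _
    have hmeas : AEStronglyMeasurable (fun x => ν • (Δ v) x) volume :=
      (cΔ.const_smul ν).aestronglyMeasurable
    exact lintegral_enorm_sq_lt_top_of_norm_le_add hle hmeas l2νΔ l2Wc
  have l2Dπ : ∫⁻ x, ‖fderiv ℝ π x‖ₑ ^ 2 < ⊤ :=
    lintegral_enorm_sq_lt_top_of_norm_le (fun x => (n_gπ x).symm.le) l2gπ
  have l2div : ∀ i, ∫⁻ x, ‖fderiv ℝ v x (e i)‖ₑ ^ 2 < ⊤ := fun i =>
    lintegral_enorm_sq_lt_top_of_norm_le (fun x => by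
      simpa [he1] using (fderiv ℝ v x).le_opNorm (e i)) l2Dv
  have l2diz : ∀ i, ∫⁻ x, ‖fderiv ℝ z x (e i)‖ₑ ^ 2 < ⊤ := fun i =>
    lintegral_enorm_sq_lt_top_of_norm_le (fun x => by
      simpa [he1] using (fderiv ℝ z x).le_opNorm (e i)) l2Dz
  have l2ddv : ∀ i, ∫⁻ x, ‖fderiv ℝ (fun y => fderiv ℝ v y (e i)) x (e i)‖ₑ ^ 2 < ⊤ := fun i =>
    lintegral_enorm_sq_lt_top_of_norm_le (fun x => norm_fderiv_fderiv_apply_basisFun_le hv x i) l2D2v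
  have l2diπ : ∀ i, ∫⁻ x, ‖fderiv ℝ π x (e i)‖ₑ ^ 2 < ⊤ := fun i =>
    lintegral_enorm_sq_lt_top_of_norm_le (fun x => by
      simpa [he1] using (fderiv ℝ π x).le_opNorm (e i)) l2Dπ
  -- integrability of the pairings with `z`
  have c3D2 : Continuous fun x => (3 : ℝ) • iteratedFDeriv ℝ 2 v x := cD2v.const_smul (3 : ℝ)
  have izΔ : Integrable (fun x => ⟪z x, (Δ v) x⟫) volume :=
    integrable_of_norm_le_mul_of_lintegral_sq (cz.inner cΔ).aestronglyMeasurable cz c3D2 l2z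
      (lintegral_enorm_sq_const_smul_lt_top 3 l2D2v)
      fun x => (norm_inner_le_norm _ _).trans (mul_le_mul_of_nonneg_left (n_Δ x) (norm_nonneg _))
  have izg : Integrable (fun x => ⟪z x, gradient π x⟫) volume :=
    integrable_of_norm_le_mul_of_lintegral_sq (cz.inner cgπ).aestronglyMeasurable cz cgπ l2z l2gπ
      fun x => norm_inner_le_norm _ _
  have izc : Integrable (fun x => ⟪z x, convect v v x⟫) volume :=
    integrable_of_norm_le_mul_of_lintegral_sq (cz.inner cconv).aestronglyMeasurable cz cconv l2z
      l2conv fun x => norm_inner_le_norm _ _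
  have isqz : Integrable (fun x => ‖z x‖ ^ 2) volume := integrable_sq_norm_of_lintegral_lt_top cz l2z
  -- integrability of the Frobenius densities
  have ifrobv : Integrable (fun x => frobeniusNormSq (fderiv ℝ v x)) volume := by
    have hlt : ∫⁻ x, ENNReal.ofReal (frobeniusNormSq (fderiv ℝ v x)) < ⊤ :=
      calc ∫⁻ x, ENNReal.ofReal (frobeniusNormSq (fderiv ℝ v x))
          ≤ ∫⁻ x, 3 * ‖fderiv ℝ v x‖ₑ ^ 2 :=
            lintegral_mono fun x => ofReal_frobeniusNormSq_le_three_mul_enorm_sq _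
        _ = 3 * ∫⁻ x, ‖fderiv ℝ v x‖ₑ ^ 2 := lintegral_const_mul' _ _ (by norm_num)
        _ < ⊤ := ENNReal.mul_lt_top (by norm_num) l2Dv
    exact integrable_of_continuous_of_nonneg (continuous_frobeniusNormSq_fderiv hv (by simp))
      (fun x => frobeniusNormSq_nonneg _) hlt
  have ifrobU : Integrable (fun x => frobeniusNormSq (fderiv ℝ U x)) volume := by
    have hlt : ∫⁻ x, ENNReal.ofReal (frobeniusNormSq (fderiv ℝ U x)) < ⊤ :=
      calc ∫⁻ x, ENNReal.ofReal (frobeniusNormSq (fderiv ℝ U x))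
          ≤ ∫⁻ x, 3 * ‖fderiv ℝ U x‖ₑ ^ 2 :=
            lintegral_mono fun x => ofReal_frobeniusNormSq_le_three_mul_enorm_sq _
        _ = 3 * ∫⁻ x, ‖fderiv ℝ U x‖ₑ ^ 2 := lintegral_const_mul' _ _ (by norm_num)
        _ < ⊤ := ENNReal.mul_lt_top (by norm_num) l2DU
    exact integrable_of_continuous_of_nonneg (continuous_frobeniusNormSq_fderiv hU (by simp))
      (fun x => frobeniusNormSq_nonneg _) hlt
  -- (i) diffusion: `ν ∫⟪z, Δv⟫ ≤ (ν/4) ∫ |DU|²`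
  have i1 : ∀ i, Integrable (fun x => ⟪fderiv ℝ (fun y => fderiv ℝ v y (e i)) x (e i), z x⟫)
      volume := fun i =>
    integrable_of_norm_le_mul_of_lintegral_sq ((cddv i).inner cz).aestronglyMeasurable (cddv i) cz
      (l2ddv i) l2z fun x => norm_inner_le_norm _ _
  have i2 : ∀ i, Integrable (fun x => ⟪fderiv ℝ v x (e i), fderiv ℝ z x (e i)⟫) volume := fun i =>
    integrable_of_norm_le_mul_of_lintegral_sq ((cdiv i).inner (cdiz i)).aestronglyMeasurable
      (cdiv i) (cdiz i) (l2div i) (l2diz i) fun x => norm_inner_le_norm _ _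
  have i3 : ∀ i, Integrable (fun x => ⟪fderiv ℝ v x (e i), z x⟫) volume := fun i =>
    integrable_of_norm_le_mul_of_lintegral_sq ((cdiv i).inner cz).aestronglyMeasurable (cdiv i) cz
      (l2div i) l2z fun x => norm_inner_le_norm _ _
  have hG := integral_sum_inner_fderiv_fderiv_eq_neg_integral_inner_laplacian hv hz i1 i2 i3
  have hdiff : ν * ∫ x, ⟪z x, (Δ v) x⟫ ≤ ν / 4 * ∫ x, frobeniusNormSq (fderiv ℝ U x) := by
    have hcomm : ∫ x, ⟪z x, (Δ v) x⟫ = ∫ x, ⟪(Δ v) x, z x⟫ :=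
      integral_congr_ae (Eventually.of_forall fun x => real_inner_comm _ _)
    have hpt : ∀ x, -∑ i, ⟪fderiv ℝ v x (e i), fderiv ℝ z x (e i)⟫ ≤
        frobeniusNormSq (fderiv ℝ U x) / 4 := fun x => by
      rw [frobeniusNormSq_eq_sum e, Finset.sum_div, ← Finset.sum_neg_distrib]
      refine Finset.sum_le_sum fun i _ => ?_
      rw [hfdz x, FunLike.coe_sub, Pi.sub_apply]
      exact neg_inner_self_sub_le _ _
    have hisum : Integrable (fun x => ∑ i, ⟪fderiv ℝ v x (e i), fderiv ℝ z x (e i)⟫) volume :=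
      integrable_finsetSum _ fun i _ => i2 i
    have hle : -∫ x, ∑ i, ⟪fderiv ℝ v x (e i), fderiv ℝ z x (e i)⟫ ≤
        ∫ x, frobeniusNormSq (fderiv ℝ U x) / 4 := by
      rw [← integral_neg]
      exact integral_mono hisum.neg (ifrobU.div_const 4) hpt
    rw [integral_div] at hle
    have h1 : ∫ x, ⟪z x, (Δ v) x⟫ ≤ (∫ x, frobeniusNormSq (fderiv ℝ U x)) / 4 := by
      rw [hcomm]; linarith [hG, hle]
    have h2 := mul_le_mul_of_nonneg_left h1 hν
    linarith
  -- (ii) pressure: `∫⟪z, ∇π⟫ = 0`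
  have hpress : ∫ x, ⟪z x, gradient π x⟫ = 0 := by
    have hswap : (fun x => ⟪z x, gradient π x⟫) = fun x => ⟪gradient π x, z x⟫ :=
      funext fun x => real_inner_comm _ _
    rw [hswap]
    refine integral_inner_gradient_eq_zero_of_isDivFree_R3 hπ hz hdivz (fun i => ?_) (fun i => ?_)
      (fun i => ?_)
    · refine integrable_of_norm_le_mul_of_lintegral_sq
        ((continuous_const.inner cz).mul (cdiπ i)).aestronglyMeasurable cz (cdiπ i) l2z (l2diπ i)
        fun x => ?_
      rw [norm_mul]
      exact mul_le_mul (hin i _) le_rfl (norm_nonneg _) (norm_nonneg _)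
    · refine integrable_of_norm_le_mul_of_lintegral_sq
        ((continuous_const.inner (cdiz i)).mul cπ).aestronglyMeasurable (cdiz i) cπ (l2diz i) l2π
        fun x => ?_
      rw [norm_mul]
      exact mul_le_mul (hin i _) le_rfl (norm_nonneg _) (norm_nonneg _)
    · refine integrable_of_norm_le_mul_of_lintegral_sq
        ((continuous_const.inner cz).mul cπ).aestronglyMeasurable cz cπ l2z l2π fun x => ?_
      rw [norm_mul]
      exact mul_le_mul (hin i _) le_rfl (norm_nonneg _) (norm_nonneg _)
  -- (iii) transport: `-∫⟪z, (v·∇)v⟫ ≤ (λ/2)∫‖z‖² + (M²/(2λ))∫|Dv|²`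
  have htrans : -∫ x, ⟪z x, convect v v x⟫ ≤
      lam / 2 * (∫ x, ‖z x‖ ^ 2) + M ^ 2 / (2 * lam) * ∫ x, frobeniusNormSq (fderiv ℝ v x) := by
    have hpt : ∀ x, -⟪z x, convect v v x⟫ ≤
        lam / 2 * ‖z x‖ ^ 2 + M ^ 2 / (2 * lam) * frobeniusNormSq (fderiv ℝ v x) := fun x =>
      neg_inner_apply_le (z x) (v x) (fderiv ℝ v x) (hM x) hlam
    have iR : Integrable (fun x => lam / 2 * ‖z x‖ ^ 2 +
        M ^ 2 / (2 * lam) * frobeniusNormSq (fderiv ℝ v x)) volume :=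
      (isqz.const_mul _).add (ifrobv.const_mul _)
    calc -∫ x, ⟪z x, convect v v x⟫ = ∫ x, -⟪z x, convect v v x⟫ := (integral_neg _).symm
      _ ≤ ∫ x, (lam / 2 * ‖z x‖ ^ 2 + M ^ 2 / (2 * lam) * frobeniusNormSq (fderiv ℝ v x)) :=
          integral_mono izc.neg iR hpt
      _ = lam / 2 * (∫ x, ‖z x‖ ^ 2) + M ^ 2 / (2 * lam) * ∫ x, frobeniusNormSq (fderiv ℝ v x) := by
          rw [integral_add (isqz.const_mul _) (ifrobv.const_mul _), integral_const_mul,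
            integral_const_mul]
  -- assemble: `⟪z, W⟫ = ν⟪z, Δv⟫ - ⟪z, ∇π⟫ - ⟪z, (v·∇)v⟫`
  have hW_eq : ∀ x, W x = ν • (Δ v) x - gradient π x - convect v v x := fun x => by
    rw [← hmom x]; abel
  have hsplit : ∫ x, ⟪z x, W x⟫ =
      ν * (∫ x, ⟪z x, (Δ v) x⟫) - (∫ x, ⟪z x, gradient π x⟫) - ∫ x, ⟪z x, convect v v x⟫ := by
    have e1 : (fun x => ⟪z x, W x⟫) =
        fun x => (ν * ⟪z x, (Δ v) x⟫ - ⟪z x, gradient π x⟫) - ⟪z x, convect v v x⟫ := by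
      funext x
      rw [hW_eq x, inner_sub_right, inner_sub_right, real_inner_smul_right]
    have i12 : Integrable (fun x => ν * ⟪z x, (Δ v) x⟫ - ⟪z x, gradient π x⟫) volume :=
      (izΔ.const_mul ν).sub izg
    rw [e1, integral_sub i12 izc, integral_sub (izΔ.const_mul ν) izg, integral_const_mul]
  have hzW : ∫ x, ⟪v x - U x, W x⟫ = ∫ x, ⟪z x, W x⟫ :=
    integral_congr_ae (Eventually.of_forall fun x => by simp only [hzx])
  have hzE : ∫ x, ‖v x - U x‖ ^ 2 = ∫ x, ‖z x‖ ^ 2 :=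
    integral_congr_ae (Eventually.of_forall fun x => by simp only [hzx])
  rw [hzW, hzE, hsplit, hpress]
  have e2 : M ^ 2 / lam * ∫ x, frobeniusNormSq (fderiv ℝ v x) =
      2 * (M ^ 2 / (2 * lam) * ∫ x, frobeniusNormSq (fderiv ℝ v x)) := by
    field_simp
  rw [e2]
  linarith

end EdgeLaw

end Summit.NavierStokesRegularity.NavierStokesRegularity.Theorems

end
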